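import Literature.NumberTheory.GaloisCohomology.Howard2004.ConjugationDatumOfLifts
import Literature.NumberTheory.GaloisRepresentations.UnramifiedClassesInertia
import HarnessLib

/-!
# Howard 2004, §1.3: conjugation by `τ` carries `H¹_ur(K_v̄, T)` onto `H¹_ur(K_v, Tw T)`

Topic `NumberTheory/GaloisCohomology/Howard2004` (sequel to `SelmerTriples` §H (`ConjugationDatum`, `transportH1`) and
`ConjugationDatumOfLifts`; theorems only — no definition, no named fact, no instance, no `sorry`).

Howard 2004, §1.3 [arXiv:1202.6340 p. 7 L44–48]: «conjugation by `τ` induces an isomorphism `H¹(K_v̄, T) ≅ H¹(K_v, Tw(T))`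
where `v̄ = v^τ`», and H.4 pairs `H¹_F(K_v, T)` with (the transport of) `H¹_F(K_v̄, T)`.  Off `Σ(F)` both conditions are
the unramified ones (Def. 1.1.10), so H.4 there needs: **the transport carries the unramified condition at `v̄` onto the
unramified condition of `Tw T` at `v`** — the hypothesis `hFbar` of `DualityDatum.isSelfOrthogonalAt_of_unramified`
(`Howard2004/UnramifiedSelfOrthogonal.lean`).  This file proves it:

* `§1` cocycle formulas: `transportH1 [c] = [h ↦ δ_v · c(φ_v h)]` (`transportH1_oneCocycleClass`).
* `§2` for ANY conjugation datum `cd` whose local transport `φ_v : Γ_{K_v} → Γ_{K_v̄}` matches the inertia groups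
  (`g ∈ I_{K_v} ↔ φ_v g ∈ I_{K_v̄}`): **`map_transportH1_unramifiedSubgroup_eq`** —
  `transportH1 (H¹_ur(K_v̄, T)) = H¹_ur(K_v, Tw T)` (cocycle level: a class is unramified iff a representative is
  principal on the inertia group, `oneCocycleClass_mem_unramifiedSubgroup_iff_exists`; the compatibility
  `res_v̄ (φ_v g) = δ_v⁻¹ (τ⁻¹ res_v(g) τ) δ_v` of the datum; the inverse of the continuous bijection `φ_v` of compact groups).
* `§3` the inertia hypothesis for the CANONICAL datum `ConjugationDatum.ofLifts` (conjugation by a lift `Θ_v` of the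
  valuative transport of completions `K_{σ v} ≃+* K_v`): `conjGalHom_mem_absInertia` (conjugation by a lift of a ring
  isomorphism of local fields that respects the unit integers `N ∈ ℕ` preserves the inertia groups — `I_F` is the fixator
  of the roots of unity of order prime to `p`, `mem_absInertia_iff_smul_rootsOfUnity`), the valuative transport preserves
  the valuation rings (`valued_galAdicCompletionMap`), whence **`ofLifts_map_transportH1_unramifiedSubgroup_eq`**.

HONEST FRAMING: local Galois-cohomology bookkeeping for the typed objects of the cell `pub/bsd-print-x9` (Howard's H.4 at
the places `v ∤ pN`); BSD is not proved by any of this.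

References: [Howard2004HeegnerKolyvagin] B. Howard, *The Heegner point Kolyvagin system*, Compositio Math. 140 (2004),
§1.1 Def. 1.1.1/1.1.10, §1.3 (arXiv:1202.6340 pp. 5–7); [SerreLocalFields1979] IV §4 Cor. 2 to Prop. 16;
[SerreGaloisCohomology1997] I §2.4, II §1.1; [MilneADT2006] I §2.
-/

set_option autoImplicit false

noncomputable section

open Function NumberField IsDedekindDomain Field ValuativeRel
open scoped NumberField Classical

namespace Literature.NumberTheory.GaloisCohomology.Howard2004

open Literature.NumberTheory.GaloisRepresentations Literature.NumberTheory.GaloisRepresentations.DiscreteGaloisModule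
open Literature.NumberTheory.EllipticCurves Literature.NumberTheory.Automorphic

namespace ConjugationDatum

variable {K : Type} [Field K] [NumberField K] {M : Type} [AddCommGroup M] [TopologicalSpace M]
  [DiscreteTopology M]

/-! ## §1 The transport on cocycles -/

/-- The coefficient map of the transport is `m ↦ δ_v · m`. [cite: Howard2004HeegnerKolyvagin, §1.3 (arXiv p. 7, L44–48)] -/
theorem transportHom_hom_apply (cd : ConjugationDatum K) (ρ : DiscreteGaloisModule K M)
    (v : HeightOneSpectrum (𝓞 K)) (m : M) : (cd.transportHom ρ v).hom m = ρ (cd.δ v) m := rfl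

/-- **`transportH1 [c] = [h ↦ δ_v · c(φ_v h)]`** on continuous crossed homomorphisms.
[cite: Howard2004HeegnerKolyvagin, §1.3 (arXiv p. 7, L44–48)] [cite: SerreGaloisCohomology1997, I §2.4 (compatible pairs)] -/
theorem transportH1_oneCocycleClass (cd : ConjugationDatum K) (ρ : DiscreteGaloisModule K M)
    (v : HeightOneSpectrum (𝓞 K)) (c : contOneCocycles (ρ.toLocal (Sum.inr (cd.σ • v))).toTopRep) :
    cd.transportH1 ρ v (oneCocycleClass _ c) =
      oneCocycleClass _ (contOneCocycles.pullback (cd.φ v) (cd.transportHom ρ v) c) :=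
  map_oneCocycleClass _ (cd.φ v) (cd.transportHom ρ v) c

/-- The compatibility of the datum solved for `τ⁻¹ res_v(g) τ`: `τ⁻¹ res_v(g) τ = δ_v · res_v̄(φ_v g) · δ_v⁻¹`.
[cite: Howard2004HeegnerKolyvagin, §1.3 (arXiv p. 7, L44–48)] -/
theorem conj_absGaloisRestrict_eq (cd : ConjugationDatum K) (v : HeightOneSpectrum (𝓞 K))
    (g : absoluteGaloisGroup (v.adicCompletion K)) :
    cd.conj (absGaloisRestrict K (v.adicCompletion K) g) =
      cd.δ v * absGaloisRestrict K ((cd.σ • v).adicCompletion K) (cd.φ v g) * (cd.δ v)⁻¹ := by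
  rw [cd.compat v g]; group

/-! ## §2 Transport of the unramified condition for a datum matching the inertia groups -/

section General

/-- The local transport `φ_v` is a continuous bijection of compact Hausdorff groups, hence has a continuous inverse,
again multiplicative. [cite: Howard2004HeegnerKolyvagin, §1.3 (arXiv p. 7, L44–48)] -/
theorem exists_continuous_inverse_phi (cd : ConjugationDatum K) (v : HeightOneSpectrum (𝓞 K)) :
    ∃ ψ : C(absoluteGaloisGroup ((cd.σ • v).adicCompletion K), absoluteGaloisGroup (v.adicCompletion K)),
      (∀ g, cd.φ v (ψ g) = g) ∧ (∀ h, ψ (cd.φ v h) = h) ∧ ∀ g g', ψ (g * g') = ψ g * ψ g' := by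
  haveI : CompactSpace (absoluteGaloisGroup (v.adicCompletion K)) := absoluteGaloisGroup_compactSpace _
  let e : absoluteGaloisGroup (v.adicCompletion K) ≃* absoluteGaloisGroup ((cd.σ • v).adicCompletion K) :=
    MulEquiv.ofBijective (cd.φ v) (cd.φ_bijective v)
  have he : Continuous e.toEquiv := map_continuous (cd.φ v)
  have hc : Continuous e.symm := he.continuous_symm_of_equiv_compact_to_t2
  exact ⟨⟨e.symm, hc⟩, fun g => e.apply_symm_apply g, fun h => e.symm_apply_apply h,
    fun g g' => map_mul e.symm g g'⟩

/-- **`transportH1 (H¹_ur(K_v̄, T)) ≤ H¹_ur(K_v, Tw T)`** when `φ_v (I_{K_v}) ⊆ I_{K_v̄}`: a cocycle `c` principal on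
`I_{K_v̄}`, `c(τ) = τ m − m`, transports to `h ↦ δ_v c(φ_v h)`, which on `I_{K_v}` equals `h ↦ h·(δ_v m) − δ_v m` for the
twisted action. [cite: Howard2004HeegnerKolyvagin, §1.3 (arXiv p. 7, L44–48) with Def. 1.1.1 (H¹_ur)]
[cite: MilneADT2006, Ch. I §2 (unramified cohomology)] -/
theorem map_transportH1_unramifiedSubgroup_le (cd : ConjugationDatum K) (ρ : DiscreteGaloisModule K M)
    (v : HeightOneSpectrum (𝓞 K))
    (hI : ∀ g ∈ absInertia (v.adicCompletion K), cd.φ v g ∈ absInertia ((cd.σ • v).adicCompletion K)) :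
    (unramifiedSubgroup (GaloisRep.toLocal (cd.σ • v) ρ) 1).map (cd.transportH1 ρ v) ≤
      unramifiedSubgroup (GaloisRep.toLocal v (cd.twist ρ)) 1 := by
  rintro _ ⟨x, hx, rfl⟩
  obtain ⟨c, rfl⟩ := oneCocycleClass_surjective _ x
  obtain ⟨m, hm⟩ :=
    (oneCocycleClass_mem_unramifiedSubgroup_iff_exists (GaloisRep.toLocal (cd.σ • v) ρ) c).mp hx
  change cd.transportH1 ρ v (oneCocycleClass _ c) ∈ unramifiedSubgroup (GaloisRep.toLocal v (cd.twist ρ)) 1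
  rw [transportH1_oneCocycleClass]
  refine (oneCocycleClass_mem_unramifiedSubgroup_iff_exists (GaloisRep.toLocal v (cd.twist ρ)) _).mpr
    ⟨ρ (cd.δ v) m, fun τ hτ => ?_⟩
  rw [contOneCocycles.pullback_apply, hm _ (hI τ hτ), transportHom_hom_apply]
  -- `τ⁻¹ res_v(τ') τ` acts on `δ m` as `δ res_v̄(φ τ')` acts on `m`
  have aux : ρ.toRepresentation (cd.conj (absGaloisRestrict K (v.adicCompletion K) τ)) (ρ.toRepresentation (cd.δ v) m) =
      ρ.toRepresentation (cd.δ v)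
        (ρ.toRepresentation (absGaloisRestrict K ((cd.σ • v).adicCompletion K) (cd.φ v τ)) m) := by
    rw [cd.conj_absGaloisRestrict_eq v τ, map_mul, map_mul, Module.End.mul_apply, Module.End.mul_apply,
      ← Module.End.mul_apply (f := ρ.toRepresentation (cd.δ v)⁻¹), ← map_mul, inv_mul_cancel, map_one,
      Module.End.one_apply]
  change ρ.toRepresentation (cd.δ v)
      (ρ.toRepresentation (absGaloisRestrict K ((cd.σ • v).adicCompletion K) (cd.φ v τ)) m - m) =
    ρ.toRepresentation (cd.conj (absGaloisRestrict K (v.adicCompletion K) τ)) (ρ.toRepresentation (cd.δ v) m) -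
      ρ.toRepresentation (cd.δ v) m
  rw [map_sub, aux]

/-- **`transportH1 (H¹_ur(K_v̄, T)) = H¹_ur(K_v, Tw T)`** for a conjugation datum whose local transport matches the
inertia groups (`g ∈ I_{K_v} ↔ φ_v g ∈ I_{K_v̄}`; e.g. `ConjugationDatum.ofLifts`, §3).  For `⊇`, a cocycle `d` of `Tw T`
on `Γ_{K_v}` is the transport of `g ↦ δ_v⁻¹ d(φ_v⁻¹ g)` (`φ_v` is a continuous bijection of compact groups, hence a
homeomorphism), which is principal on `I_{K_v̄}` when `d` is principal on `I_{K_v}`.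
[cite: Howard2004HeegnerKolyvagin, §1.3 (arXiv p. 7, L44–48) with Def. 1.1.1/1.1.10]
[cite: MilneADT2006, Ch. I §2 (unramified cohomology)] -/
theorem map_transportH1_unramifiedSubgroup_eq (cd : ConjugationDatum K) (ρ : DiscreteGaloisModule K M)
    (v : HeightOneSpectrum (𝓞 K))
    (hI : ∀ g, g ∈ absInertia (v.adicCompletion K) ↔ cd.φ v g ∈ absInertia ((cd.σ • v).adicCompletion K)) :
    (unramifiedSubgroup (GaloisRep.toLocal (cd.σ • v) ρ) 1).map (cd.transportH1 ρ v) =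
      unramifiedSubgroup (GaloisRep.toLocal v (cd.twist ρ)) 1 := by
  refine le_antisymm (cd.map_transportH1_unramifiedSubgroup_le ρ v fun g hg => (hI g).mp hg) fun y hy => ?_
  -- read `y` in the `K_v = v.adicCompletion K` form of the local module (definitionally the same type)
  change galoisCohomology (GaloisRep.toLocal v (cd.twist ρ)) 1 at y
  obtain ⟨d, rfl⟩ := oneCocycleClass_surjective (GaloisRep.toLocal v (cd.twist ρ)).toTopRep y
  obtain ⟨w, hw⟩ :=
    (oneCocycleClass_mem_unramifiedSubgroup_iff_exists (GaloisRep.toLocal v (cd.twist ρ)) d).mp hy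
  -- `ψ = φ_v⁻¹`, continuous and multiplicative
  obtain ⟨ψ, hφψ, hψφ, hmul⟩ := cd.exists_continuous_inverse_phi v
  -- the key commutation: `δ⁻¹ (τ⁻¹ res_v(ψ g) τ) = res_v̄(g) δ⁻¹`
  have key : ∀ g : absoluteGaloisGroup ((cd.σ • v).adicCompletion K),
      (cd.δ v)⁻¹ * cd.conj (absGaloisRestrict K (v.adicCompletion K) (ψ g)) =
        absGaloisRestrict K ((cd.σ • v).adicCompletion K) g * (cd.δ v)⁻¹ := fun g => by
    rw [cd.conj_absGaloisRestrict_eq v (ψ g), hφψ]; group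
  have hcomm : ∀ (g : absoluteGaloisGroup ((cd.σ • v).adicCompletion K)) (y : M),
      ρ.toRepresentation (cd.δ v)⁻¹ (ρ.toRepresentation (cd.conj (absGaloisRestrict K (v.adicCompletion K) (ψ g))) y) =
        ρ.toRepresentation (absGaloisRestrict K ((cd.σ • v).adicCompletion K) g) (ρ.toRepresentation (cd.δ v)⁻¹ y) :=
    fun g y => by
      rw [← Module.End.mul_apply, ← map_mul, key, map_mul, Module.End.mul_apply]
  -- the cocycle `c(g) = δ_v⁻¹ · d(ψ g)` of `T` on `Γ_{K_v̄}`: unramified, and transporting to `d`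
  obtain ⟨c, hc_ur, hc_eq⟩ : ∃ c : contOneCocycles (GaloisRep.toLocal (cd.σ • v) ρ).toTopRep,
      oneCocycleClass _ c ∈ unramifiedSubgroup (GaloisRep.toLocal (cd.σ • v) ρ) 1 ∧
        contOneCocycles.pullback (cd.φ v) (cd.transportHom ρ v) c = d := by
    refine ⟨⟨⟨fun g => ρ (cd.δ v)⁻¹ (d.1 (ψ g)),
        continuous_of_discreteTopology.comp (d.1.continuous.comp ψ.continuous)⟩, fun g g' => ?_⟩, ?_, ?_⟩
    · -- cocycle identity
      change ρ.toRepresentation (cd.δ v)⁻¹ (d.1 (ψ (g * g'))) =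
        ρ.toRepresentation (cd.δ v)⁻¹ (d.1 (ψ g)) +
          ρ.toRepresentation (absGaloisRestrict K ((cd.σ • v).adicCompletion K) g)
            (ρ.toRepresentation (cd.δ v)⁻¹ (d.1 (ψ g')))
      rw [hmul, d.2 (ψ g) (ψ g')]
      change ρ.toRepresentation (cd.δ v)⁻¹ (d.1 (ψ g) +
          ρ.toRepresentation (cd.conj (absGaloisRestrict K (v.adicCompletion K) (ψ g))) (d.1 (ψ g'))) = _
      rw [map_add, hcomm]
    · -- unramified at `v̄`
      refine (oneCocycleClass_mem_unramifiedSubgroup_iff_exists (GaloisRep.toLocal (cd.σ • v) ρ) _).mpr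
        ⟨ρ (cd.δ v)⁻¹ w, fun τ hτ => ?_⟩
      have hτ' : ψ τ ∈ absInertia (v.adicCompletion K) := (hI _).mpr (by rw [hφψ]; exact hτ)
      change ρ.toRepresentation (cd.δ v)⁻¹ (d.1 (ψ τ)) =
        ρ.toRepresentation (absGaloisRestrict K ((cd.σ • v).adicCompletion K) τ) (ρ.toRepresentation (cd.δ v)⁻¹ w) -
          ρ.toRepresentation (cd.δ v)⁻¹ w
      rw [hw _ hτ']
      change ρ.toRepresentation (cd.δ v)⁻¹
          (ρ.toRepresentation (cd.conj (absGaloisRestrict K (v.adicCompletion K) (ψ τ))) w - w) = _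
      rw [map_sub, hcomm]
    · -- transports to `d`
      refine Subtype.ext (ContinuousMap.ext fun h => ?_)
      change ρ.toRepresentation (cd.δ v) (ρ.toRepresentation (cd.δ v)⁻¹ (d.1 (ψ (cd.φ v h)))) = d.1 h
      rw [hψφ, ← Module.End.mul_apply, ← map_mul, mul_inv_cancel, map_one, Module.End.one_apply]
  refine ⟨oneCocycleClass _ c, hc_ur, ?_⟩
  rw [transportH1_oneCocycleClass, hc_eq]
  rfl

end General

/-! ## §3 The canonical datum `ofLifts`: conjugation by a lift of the valuative transport preserves inertia -/

section Lifts

variable {E E' : Type} [Field E] [ValuativeRel E] [TopologicalSpace E] [IsNonarchimedeanLocalField E]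
  [Field E'] [ValuativeRel E'] [TopologicalSpace E'] [IsNonarchimedeanLocalField E']
  {θ : E ≃+* E'} {Θ : AlgebraicClosure E ≃+* AlgebraicClosure E'}

/-- **Conjugation by a lift preserves the inertia groups.**  If `Θ : Ē ≃ Ē'` lifts a ring isomorphism `θ : E ≃ E'` of
non-archimedean local fields under which every natural number that is a unit of `𝒪_E` is a unit of `𝒪_{E'}` (same
residue characteristic), then `g ↦ Θ⁻¹ g Θ` maps `I_{E'}` into `I_E`: the inertia group is the fixator of the roots of
unity of order prime to `p` (`mem_absInertia_iff_smul_rootsOfUnity`), and `Θ` permutes those.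
[cite: SerreLocalFields1979, Ch. IV §4 Cor. 2 to Prop. 16] [cite: SerreGaloisCohomology1997, II §1.1] -/
theorem conjGalHom_mem_absInertia (hΘ : IsLiftOfRingEquiv θ Θ)
    (hN : ∀ N : ℕ, IsUnit ((N : ℕ) : 𝒪[E]) → IsUnit ((N : ℕ) : 𝒪[E']))
    {g : absoluteGaloisGroup E'} (hg : g ∈ absInertia E') : hΘ.conjGalHom g ∈ absInertia E := by
  rw [mem_absInertia_iff_smul_rootsOfUnity] at hg ⊢
  intro N hNu ζ hζ
  have h1 : (Θ ζ) ^ N = 1 := by rw [← map_pow, hζ, map_one]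
  have h2 := hg N (hN N hNu) (Θ ζ) h1
  rw [absoluteGaloisGroup.smul_def] at h2 ⊢
  change Θ.symm ((show AlgebraicClosure E' ≃ₐ[E'] AlgebraicClosure E' from g) (Θ ζ)) = ζ
  change (show AlgebraicClosure E' ≃ₐ[E'] AlgebraicClosure E' from g) (Θ ζ) = Θ ζ at h2
  rw [h2, RingEquiv.symm_apply_apply]

omit [TopologicalSpace E] [IsNonarchimedeanLocalField E] [TopologicalSpace E'] [IsNonarchimedeanLocalField E'] in
/-- **Unit naturals transfer along a ring isomorphism respecting the valuation rings**: if `θ(𝒪_E) ⊆ 𝒪_{E'}` then a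
natural number invertible in `𝒪_E` is invertible in `𝒪_{E'}`. [folklore] -/
private theorem isUnit_natCast_of_ringEquiv (θ : E ≃+* E') (hθ : ∀ x : E, x ∈ 𝒪[E] → θ x ∈ 𝒪[E']) (N : ℕ)
    (h : IsUnit ((N : ℕ) : 𝒪[E])) : IsUnit ((N : ℕ) : 𝒪[E']) := by
  obtain ⟨u, hu⟩ := h.exists_right_inv
  have hu' : (N : E) * (u : E) = 1 := by
    have := congrArg (fun z : 𝒪[E] => (z : E)) hu
    simpa using this
  refine IsUnit.of_mul_eq_one ⟨θ u, hθ u u.2⟩ (Subtype.ext ?_)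
  change ((N : 𝒪[E']) : E') * θ u = 1
  have hN' : ((N : 𝒪[E']) : E') = θ (N : E) := by simp
  rw [hN', ← map_mul, hu', map_one]

/-- The valuative transport of completions `K_w ≃+* K_{w'}` (`galAdicCompletionEquiv`) maps the valuation ring into the
valuation ring (it preserves `Valued.v`, `valued_galAdicCompletionMap`). [cite: CasselsFrohlichANT1967, Ch. VII §1.1] -/
theorem galAdicCompletionMap_mem_integer (σ : K ≃ₐ[ℚ] K) {w w' : HeightOneSpectrum (𝓞 K)} (h : σ • w = w')
    (x : w.adicCompletion K) (hx : x ∈ 𝒪[w.adicCompletion K]) :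
    galAdicCompletionMap (L := K) σ h x ∈ 𝒪[w'.adicCompletion K] := by
  have h1 : x ∈ 𝒪[w.adicCompletion K] ↔ Valued.v x ≤ 1 := by
    rw [Valuation.mem_integer_iff, ← (ValuativeRel.valuation (w.adicCompletion K)).map_one,
      ← Valuation.vle_iff_le, Valuation.vle_iff_le (Valued.v), map_one]
  have h2 : galAdicCompletionMap (L := K) σ h x ∈ 𝒪[w'.adicCompletion K] ↔
      Valued.v (galAdicCompletionMap (L := K) σ h x) ≤ 1 := by
    rw [Valuation.mem_integer_iff, ← (ValuativeRel.valuation (w'.adicCompletion K)).map_one,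
      ← Valuation.vle_iff_le, Valuation.vle_iff_le (Valued.v), map_one]
  rw [h2, valued_galAdicCompletionMap]
  exact h1.mp hx

/-- Unit naturals of `𝒪_{K_{σ v}}` are unit naturals of `𝒪_{K_v}` (through the transport `theta`).
[cite: CasselsFrohlichANT1967, Ch. VII §1.1] -/
theorem isUnit_natCast_of_isUnit_theta {σ : K ≃ₐ[ℚ] K} (hσ : σ * σ = 1) (v : HeightOneSpectrum (𝓞 K)) (N : ℕ)
    (h : IsUnit ((N : ℕ) : 𝒪[(σ • v).adicCompletion K])) : IsUnit ((N : ℕ) : 𝒪[v.adicCompletion K]) :=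
  isUnit_natCast_of_ringEquiv (theta hσ v)
    (fun x hx => galAdicCompletionMap_mem_integer σ (by rw [smul_smul, hσ, one_smul]) x hx) N h

/-- Unit naturals of `𝒪_{K_v}` are unit naturals of `𝒪_{K_{σ v}}` (through `theta⁻¹`, the transport along `σ⁻¹`).
[cite: CasselsFrohlichANT1967, Ch. VII §1.1] -/
theorem isUnit_natCast_of_isUnit_theta_symm {σ : K ≃ₐ[ℚ] K} (hσ : σ * σ = 1) (v : HeightOneSpectrum (𝓞 K)) (N : ℕ)
    (h : IsUnit ((N : ℕ) : 𝒪[v.adicCompletion K])) : IsUnit ((N : ℕ) : 𝒪[(σ • v).adicCompletion K]) :=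
  isUnit_natCast_of_ringEquiv (theta hσ v).symm
    (fun x hx => by
      rw [theta, galAdicCompletionEquiv_symm_apply]
      exact galAdicCompletionMap_mem_integer σ⁻¹ _ x hx) N h

/-- **The local transport `φ_v` of `ofLifts` matches the inertia groups**: `g ∈ I_{K_v} ↔ φ_v g ∈ I_{K_{σ v}}`.
[cite: Howard2004HeegnerKolyvagin, §1.3 (arXiv p. 7, L44–48)] [cite: SerreLocalFields1979, Ch. IV §4 Cor. 2 to Prop. 16] -/
theorem phi_mem_absInertia_iff {σ : K ≃ₐ[ℚ] K} (hσ : σ * σ = 1) (v : HeightOneSpectrum (𝓞 K))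
    (g : absoluteGaloisGroup (v.adicCompletion K)) :
    g ∈ absInertia (v.adicCompletion K) ↔ phi hσ v g ∈ absInertia ((σ • v).adicCompletion K) := by
  constructor
  · intro hg
    exact conjGalHom_mem_absInertia (isLift_theta hσ v) (isUnit_natCast_of_isUnit_theta hσ v) hg
  · intro hg
    have h := conjGalHom_mem_absInertia (isLift_theta hσ v).symm (isUnit_natCast_of_isUnit_theta_symm hσ v) hg
    have e : (isLift_theta hσ v).symm.conjGalHom (phi hσ v g) = g :=
      DFunLike.congr_fun (isLift_theta hσ v).symm.conjGalCMH_comp_symm g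
    rwa [e] at h

/-- **For the canonical datum `ofLifts`: `transportH1 (H¹_ur(K_{σ v}, T)) = H¹_ur(K_v, Tw T)`** at every finite place `v`
and for every discrete `Γ_K`-module `T` — the hypothesis `hFbar` of `DualityDatum.isSelfOrthogonalAt_of_unramified` for
Selmer structures unramified at `v` and `σ v`.
[cite: Howard2004HeegnerKolyvagin, §1.3 (arXiv p. 7, L44–48) with Def. 1.1.10] [cite: MilneADT2006, Ch. I §2] -/
theorem ofLifts_map_transportH1_unramifiedSubgroup_eq (σ : K ≃ₐ[ℚ] K) (hσ₁ : σ ≠ 1) (hσ : σ * σ = 1)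
    (τ : AlgebraicClosure K ≃+* AlgebraicClosure K) (hτ : IsLiftOfAut σ τ) (hτ₂ : Function.Involutive τ)
    (ρ : DiscreteGaloisModule K M) (v : HeightOneSpectrum (𝓞 K)) :
    (unramifiedSubgroup (GaloisRep.toLocal (σ • v) ρ) 1).map ((ofLifts σ hσ₁ hσ τ hτ hτ₂).transportH1 ρ v) =
      unramifiedSubgroup (GaloisRep.toLocal v ((ofLifts σ hσ₁ hσ τ hτ hτ₂).twist ρ)) 1 :=
  (ofLifts σ hσ₁ hσ τ hτ hτ₂).map_transportH1_unramifiedSubgroup_eq ρ v (phi_mem_absInertia_iff hσ v)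

end Lifts

end ConjugationDatum

end Literature.NumberTheory.GaloisCohomology.Howard2004
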